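import Mathlib

/-!
# `ExactLifting` forces a superpolynomial `rk₊₊ / rk₊` gap (Hrubeš 2020, Open Problem 4)

Support file for crux `ConvexGateBlind` (stmt-PneNP-10680), line `xor-door-perfect-completeness`
(skeleton `Cruxes/ConvexGateBlind/Lines/xor_door_perfect_completeness.lean`), stub `stub_exactLifting`.

The line's load-bearing open stub `ExactLifting` lower-bounds, for an unsatisfiable 3-sparse affine
system `F` over `𝔽₂` carrying a degree-`d` perfect-completeness pseudo-expectation, the cone
(`PSD_q ⊕ ℝ^r_{≥0}`) factorisation size of EVERY shift `lift_t(viol_F) - ε`, `ε > 0`, of the Index-lift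
`lift_t(viol_F)[x,w] = viol_F(x[w])`, by `t^{φ(d)}` with `φ` unbounded.

This file records two elementary facts which CLASSIFY that stub:

* `coneFact_lift_viol` — the unshifted lift is cheap: `lift_t(viol_F)` is a sum of `#F · t³`
  non-negative rank-one 0/1 matrices (one per equation and pointer triple), i.e.
  `rk₊(lift_t(viol_F)) ≤ #F · t³` for every `F` and `t` (the `ε = 0` triviality of the line card).
* `exactLifting_strict` — under `ExactLifting`, every non-negative factorisation of the UNSHIFTED,
  entrywise positive integer matrix `lift_t(viol_F)` one of whose rank-one terms is entrywise positive
  (in particular every strictly positive factorisation, Hrubeš's `rk₊₊`) has at least `t^{φ(d)} - 1`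
  terms (`t ≥ T(F)`): a positive rank-one term `a ⊗ b` yields the shift `ε = (min a)(min b) > 0` at the
  cost of one extra term (Hrubeš 2020, Lemma 14 / Proposition 17).

Consequently (`exactLifting_rank_gap`) `ExactLifting` together with the line's other stub
`PerfectCompleteness` produces, for every exponent `K`, an explicit family of positive matrices with
`rk₊ ≤ #F · t³` but `rk₊₊ ≥ t^K - 1`, i.e. a superpolynomial separation of strict rank from
non-negative rank for explicit matrices — this is Open Problem 4 of Hrubeš, *On ε-sensitive monotone
computations*, Comput. Complexity 29 (2020) (ECCC TR19-034, §7), which by his Observation 21 also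
answers his Open Problem 3 (an explicit monotone function of superpolynomial monotone separation
complexity). So the LP part of `stub_exactLifting` alone is at least as strong as these open problems;
no claim about their truth is made here.

The definitions `Pool`, `Sat`, `viol`, `HasConeFact`, `IsJunta`, `HasPerfectPseudoExp`,
`PerfectCompleteness`, `ExactLifting` below are VERBATIM copies of the line skeleton's (namespace
`Summit.PneNP.PneNP.Cruxes.ConvexGateBlind.XorDoorPerfectCompleteness`), so the statements transfer by
unfolding.
-/

set_option linter.dupNamespace false -- `Summit.PneNP.PneNP.…`: summit = sub-problem (D-0017)

namespace Summit.PneNP.PneNP.Theorems.XorDoor.StrictRank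

open scoped BigOperators Classical
open Finset Matrix

noncomputable section

/-! ## §0 The line's objects (verbatim copies of the skeleton's definitions) -/

/-- The pool of 3-sparse affine equations `y i + y j + y l = b` over `𝔽₂` on `n` variables.
[verbatim copy of the line skeleton] -/
abbrev Pool (n : ℕ) : Type := Fin n × Fin n × Fin n × ZMod 2

/-- `y` satisfies the pool equation `e`. [verbatim copy of the line skeleton] -/
def Sat {n : ℕ} (y : Fin n → ZMod 2) (e : Pool n) : Prop :=
  y e.1 + y e.2.1 + y e.2.2.1 = e.2.2.2

/-- The number of equations of the system `F` violated by `y`. [verbatim copy of the line skeleton] -/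
def viol {m : ℕ} (F : Finset (Pool m)) (y : Fin m → ZMod 2) : ℕ :=
  (F.filter fun e => ¬ Sat y e).card

/-- A `(PSD_q ⊕ ℝ^r_{≥0})`-factorisation of the real matrix `M`. [verbatim copy of the line skeleton] -/
def HasConeFact {α β : Type} (M : α → β → ℝ) (q r : ℕ) : Prop :=
  ∃ (H : α → Matrix (Fin q) (Fin q) ℝ) (Y : β → Matrix (Fin q) (Fin q) ℝ)
    (U : α → Fin r → ℝ) (V : Fin r → β → ℝ),
    (∀ a, (H a).PosSemidef) ∧ (∀ b, (Y b).PosSemidef) ∧ (∀ a l, 0 ≤ U a l) ∧ (∀ l b, 0 ≤ V l b) ∧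
    ∀ a b, M a b = (H a * Y b).trace + ∑ l, U a l * V l b

/-- `h` depends on at most `d` coordinates. [verbatim copy of the line skeleton] -/
def IsJunta {m : ℕ} (d : ℕ) (h : (Fin m → ZMod 2) → ℝ) : Prop :=
  ∃ S : Finset (Fin m), S.card ≤ d ∧ ∀ x y : Fin m → ZMod 2, (∀ i ∈ S, x i = y i) → h x = h y

/-- A degree-`d` perfect-completeness (SA + SOS) pseudo-expectation for `F`.
[verbatim copy of the line skeleton] -/
def HasPerfectPseudoExp {m : ℕ} (d : ℕ) (F : Finset (Pool m)) : Prop :=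
  ∃ E : ((Fin m → ZMod 2) → ℝ) →ₗ[ℝ] ℝ,
    (∀ h : (Fin m → ZMod 2) → ℝ, IsJunta d h → (∀ x, 0 ≤ h x) → 0 ≤ E h) ∧
    (∀ s : (Fin m → ZMod 2) → ℝ,
      s ∈ Submodule.span ℝ {f : (Fin m → ZMod 2) → ℝ | IsJunta (d / 2) f} → 0 ≤ E (s * s)) ∧
    E (fun _ => 1) = 1 ∧ E (fun y => (viol F y : ℝ)) = 0

/-- Perfect completeness at every degree. [verbatim copy of the line skeleton] -/
def PerfectCompleteness : Prop :=
  ∀ d : ℕ, ∃ (m : ℕ) (F : Finset (Pool m)),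
    (¬ ∃ y : Fin m → ZMod 2, ∀ e ∈ F, Sat y e) ∧ HasPerfectPseudoExp d F

/-- ε-exact lifting, asymptotic form (the line's open stub). [verbatim copy of the line skeleton] -/
def ExactLifting : Prop :=
  ∃ φ : ℕ → ℕ, (∀ K : ℕ, ∃ d : ℕ, K ≤ φ d) ∧
    ∀ (m d : ℕ) (F : Finset (Pool m)),
      (¬ ∃ y : Fin m → ZMod 2, ∀ e ∈ F, Sat y e) → HasPerfectPseudoExp d F →
      ∃ T : ℕ, ∀ (t : ℕ) (ε : ℝ), T ≤ t → 0 < ε → ∀ q r : ℕ,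
        HasConeFact (fun (x : Fin m → Fin t → ZMod 2) (w : Fin m → Fin t) =>
          (viol F (fun i => x i (w i)) : ℝ) - ε) q r →
        t ^ φ d ≤ q + r

/-! ## §1 The unshifted lift is a sum of `#F · t³` non-negative rank-one 0/1 matrices -/

/-- Pointwise, the violation count is the sum of the violation indicators of the equations. [folklore] -/
theorem viol_eq_sum {m : ℕ} (F : Finset (Pool m)) (y : Fin m → ZMod 2) :
    (viol F y : ℝ) = ∑ e : F, if Sat y e.1 then (0 : ℝ) else 1 := by
  unfold viol
  rw [Finset.sum_coe_sort F (fun e => if Sat y e then (0 : ℝ) else 1)]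
  rw [Finset.natCast_card_filter]
  refine Finset.sum_congr rfl fun e _ => ?_
  by_cases h : Sat y e <;> simp [h]

/-- **The `ε = 0` triviality, quantitatively.** For every 3-sparse system `F` on `m` variables and every
gadget size `t`, the Index-lift `(x, w) ↦ viol_F(x[w])` has a purely non-negative
(`q = 0`) cone factorisation with `#F · t³` terms: one 0/1 rectangle
`[x violates e at the cells (p,q,s)] · [w points e to (p,q,s)]` per equation `e ∈ F` and pointer
triple `(p,q,s)`. Hence `rk₊(lift_t(viol_F)) ≤ #F · t³`. [folklore] -/
theorem coneFact_lift_viol (m t : ℕ) (F : Finset (Pool m)) :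
    HasConeFact (fun (x : Fin m → Fin t → ZMod 2) (w : Fin m → Fin t) =>
      (viol F (fun i => x i (w i)) : ℝ)) 0 (F.card * t ^ 3) := by
  -- index the terms by (equation, pointer triple)
  have hcard : Fintype.card (F × (Fin t × Fin t × Fin t)) = F.card * t ^ 3 := by
    simp only [Fintype.card_prod, Fintype.card_coe, Fintype.card_fin]
    ring
  obtain ⟨σ⟩ : Nonempty ((F × (Fin t × Fin t × Fin t)) ≃ Fin (F.card * t ^ 3)) :=
    ⟨Fintype.equivFinOfCardEq hcard⟩
  -- the rectangle factors
  set A : (Fin m → Fin t → ZMod 2) → (F × (Fin t × Fin t × Fin t)) → ℝ := fun x c =>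
    if x c.1.1.1 c.2.1 + x c.1.1.2.1 c.2.2.1 + x c.1.1.2.2.1 c.2.2.2 = c.1.1.2.2.2 then 0 else 1
    with hA
  set B : (F × (Fin t × Fin t × Fin t)) → (Fin m → Fin t) → ℝ := fun c w =>
    if (w c.1.1.1, w c.1.1.2.1, w c.1.1.2.2.1) = c.2 then 1 else 0 with hB
  refine ⟨fun _ => 0, fun _ => 0, fun x l => A x (σ.symm l), fun l w => B (σ.symm l) w,
    fun _ => Matrix.PosSemidef.zero, fun _ => Matrix.PosSemidef.zero, ?_, ?_, ?_⟩
  · intro x l; simp only [hA]; split_ifs <;> norm_num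
  · intro l w; simp only [hB]; split_ifs <;> norm_num
  intro x w
  show (viol F (fun i => x i (w i)) : ℝ) =
    ((0 : Matrix (Fin 0) (Fin 0) ℝ) * 0).trace + ∑ l, A x (σ.symm l) * B (σ.symm l) w
  have htr : ((0 : Matrix (Fin 0) (Fin 0) ℝ) * 0).trace = 0 := by simp
  rw [htr, zero_add]
  -- reindex the sum over `Fin (#F·t³)` as a sum over (equation, triple)
  rw [show (∑ l, A x (σ.symm l) * B (σ.symm l) w) =
      ∑ c : F × (Fin t × Fin t × Fin t), A x c * B c w from
    Fintype.sum_equiv σ.symm _ _ (fun _ => rfl)]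
  rw [viol_eq_sum, Fintype.sum_prod_type]
  refine Finset.sum_congr rfl fun e _ => ?_
  -- the inner sum over pointer triples collapses to the pointed triple
  simp only [hB, mul_boole]
  rw [Finset.sum_ite_eq]
  simp only [Finset.mem_univ, if_true, hA, Sat]
  split_ifs <;> rfl

/-! ## §2 Strictly positive factorisations and `ExactLifting` -/

/-- **Shift from one positive rank-one term** (Hrubeš 2020, Lemma 14 / Proposition 17). If an
`α × β` matrix `M` is a sum of `r + 1` non-negative rank-one terms the first of which is entrywise
positive, then for some `ε > 0` the shifted matrix `M - ε` has a purely non-negative cone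
factorisation with `r + 2` terms: `a ⊗ b - (min a)(min b) 𝟙 ⊗ 𝟙 = (a - min a) ⊗ b + (min a) 𝟙 ⊗ (b - min b)`.
[cite: Hrubes2020, Lemma 14, Proposition 17] -/
theorem hasConeFact_shift_of_posTerm {α β : Type} [Fintype α] [Fintype β] [Nonempty α] [Nonempty β]
    (M : α → β → ℝ) {r : ℕ} (a : α → Fin (r + 1) → ℝ) (b : Fin (r + 1) → β → ℝ)
    (ha : ∀ x l, 0 ≤ a x l) (hb : ∀ l w, 0 ≤ b l w) (ha0 : ∀ x, 0 < a x 0) (hb0 : ∀ w, 0 < b 0 w)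
    (hM : ∀ x w, M x w = ∑ l, a x l * b l w) :
    ∃ ε : ℝ, 0 < ε ∧ HasConeFact (fun x w => M x w - ε) 0 (r + 2) := by
  -- minima of the positive factors
  obtain ⟨x₀, -, hx₀⟩ := Finset.exists_min_image Finset.univ (fun x => a x 0) Finset.univ_nonempty
  obtain ⟨w₀, -, hw₀⟩ := Finset.exists_min_image Finset.univ (fun w => b 0 w) Finset.univ_nonempty
  set μ : ℝ := a x₀ 0 with hμ
  set ν : ℝ := b 0 w₀ with hν
  have hμpos : 0 < μ := ha0 x₀
  have hνpos : 0 < ν := hb0 w₀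
  have hμle : ∀ x, μ ≤ a x 0 := fun x => hx₀ x (Finset.mem_univ x)
  have hνle : ∀ w, ν ≤ b 0 w := fun w => hw₀ w (Finset.mem_univ w)
  refine ⟨μ * ν, mul_pos hμpos hνpos, fun _ => 0, fun _ => 0,
    fun x => Fin.cons (a x 0 - μ) (Fin.cons μ (fun j => a x j.succ)),
    fun l w => (Fin.cons (b 0 w) (Fin.cons (b 0 w - ν) (fun j => b j.succ w)) : Fin (r + 2) → ℝ) l,
    fun _ => Matrix.PosSemidef.zero, fun _ => Matrix.PosSemidef.zero, ?_, ?_, ?_⟩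
  · intro x l
    refine Fin.cases ?_ (fun l' => ?_) l
    · simpa using hμle x
    · refine Fin.cases ?_ (fun j => ?_) l'
      · simpa using hμpos.le
      · simpa using ha x j.succ
  · intro l w
    refine Fin.cases ?_ (fun l' => ?_) l
    · simpa using hb 0 w
    · refine Fin.cases ?_ (fun j => ?_) l'
      · simpa using hνle w
      · simpa using hb j.succ w
  · intro x w
    show M x w - μ * ν = ((0 : Matrix (Fin 0) (Fin 0) ℝ) * 0).trace +
      ∑ l, (Fin.cons (a x 0 - μ) (Fin.cons μ (fun j => a x j.succ)) : Fin (r + 2) → ℝ) l *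
        (Fin.cons (b 0 w) (Fin.cons (b 0 w - ν) (fun j => b j.succ w)) : Fin (r + 2) → ℝ) l
    have htr : ((0 : Matrix (Fin 0) (Fin 0) ℝ) * 0).trace = 0 := by simp
    rw [htr, zero_add, hM x w, Fin.sum_univ_succ, Fin.sum_univ_succ (n := r + 1),
      Fin.sum_univ_succ (n := r)]
    simp only [Fin.cons_zero, Fin.cons_succ]
    ring

/-- **`ExactLifting` forces large strict rank.** Under the line's open stub `ExactLifting`, for every
unsatisfiable 3-sparse system `F` with a degree-`d` perfect-completeness pseudo-expectation there is a
gadget size `T` beyond which every non-negative factorisation of the UNSHIFTED positive integer matrix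
`lift_t(viol_F)` having an entrywise positive rank-one term — in particular every strictly positive
factorisation (Hrubeš's `rk₊₊`) — uses at least `t^{φ(d)} - 1` terms, `φ` the unbounded exponent of
`ExactLifting`. [this file] -/
theorem exactLifting_strict (hEL : ExactLifting) :
    ∃ φ : ℕ → ℕ, (∀ K : ℕ, ∃ d : ℕ, K ≤ φ d) ∧
      ∀ (m d : ℕ) (F : Finset (Pool m)),
        (¬ ∃ y : Fin m → ZMod 2, ∀ e ∈ F, Sat y e) → HasPerfectPseudoExp d F →
        ∃ T : ℕ, ∀ t : ℕ, T ≤ t → ∀ (r : ℕ)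
          (a : (Fin m → Fin t → ZMod 2) → Fin (r + 1) → ℝ) (b : Fin (r + 1) → (Fin m → Fin t) → ℝ),
          (∀ x l, 0 ≤ a x l) → (∀ l w, 0 ≤ b l w) → (∀ x, 0 < a x 0) → (∀ w, 0 < b 0 w) →
          (∀ x w, (viol F (fun i => x i (w i)) : ℝ) = ∑ l, a x l * b l w) →
          t ^ φ d ≤ r + 2 := by
  obtain ⟨φ, hφ, h⟩ := hEL
  refine ⟨φ, hφ, fun m d F hunsat hPE => ?_⟩
  obtain ⟨T, hT⟩ := h m d F hunsat hPE
  -- beyond `T + 1` the column type is non-empty, so the minima below exist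
  refine ⟨T + 1, fun t ht r a b ha hb ha0 hb0 hfact => ?_⟩
  haveI : Nonempty (Fin t) := ⟨⟨0, by omega⟩⟩
  obtain ⟨ε, hε, hcone⟩ :=
    hasConeFact_shift_of_posTerm (fun (x : Fin m → Fin t → ZMod 2) (w : Fin m → Fin t) =>
      (viol F (fun i => x i (w i)) : ℝ)) a b ha hb ha0 hb0 hfact
  simpa using hT t ε (by omega) hε 0 (r + 2) hcone

/-- **The gap, packaged (Hrubeš 2020, Open Problem 4, would follow).** `ExactLifting` and
`PerfectCompleteness` together give, for every exponent `K`, an explicit 3-sparse system `F` and a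
threshold `T` such that for all `t ≥ T` the positive integer matrix `lift_t(viol_F)` (i) is a sum of
`#F · t³` non-negative rank-one matrices, yet (ii) every non-negative factorisation of it with an entrywise
positive rank-one term — in particular every strictly positive one — has at least `t^K - 1` terms. A proof
of the two stubs would therefore exhibit explicit positive matrices whose strict rank is superpolynomial in
their non-negative rank (Hrubeš, Comput. Complexity 2020 / ECCC TR19-034, Open Problem 4; by his
Observation 21 this also answers Open Problem 3). [this file] -/
theorem exactLifting_rank_gap : ExactLifting → PerfectCompleteness → ∀ K : ℕ,
    ∃ (m : ℕ) (F : Finset (Pool m)) (T : ℕ), ∀ t : ℕ, T ≤ t →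
      HasConeFact (fun (x : Fin m → Fin t → ZMod 2) (w : Fin m → Fin t) =>
        (viol F (fun i => x i (w i)) : ℝ)) 0 (F.card * t ^ 3) ∧
      ∀ (r : ℕ) (a : (Fin m → Fin t → ZMod 2) → Fin (r + 1) → ℝ) (b : Fin (r + 1) → (Fin m → Fin t) → ℝ),
        (∀ x l, 0 ≤ a x l) → (∀ l w, 0 ≤ b l w) → (∀ x, 0 < a x 0) → (∀ w, 0 < b 0 w) →
        (∀ x w, (viol F (fun i => x i (w i)) : ℝ) = ∑ l, a x l * b l w) →
        t ^ K ≤ r + 2 := by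
  intro hEL hPC K
  obtain ⟨φ, hφ, h⟩ := exactLifting_strict hEL
  obtain ⟨d, hd⟩ := hφ K
  obtain ⟨m, F, hunsat, hPE⟩ := hPC d
  obtain ⟨T, hT⟩ := h m d F hunsat hPE
  refine ⟨m, F, T + 1, fun t ht => ⟨coneFact_lift_viol m t F, fun r a b ha hb ha0 hb0 hfact => ?_⟩⟩
  have h1 : 1 ≤ t := le_trans (Nat.le_add_left 1 T) ht
  calc t ^ K ≤ t ^ φ d := Nat.pow_le_pow_right h1 hd
    _ ≤ r + 2 := hT t (le_trans (Nat.le_succ T) ht) r a b ha hb ha0 hb0 hfact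

end

end Summit.PneNP.PneNP.Theorems.XorDoor.StrictRank
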